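import Literature.Computability.AlgebraicComplexity.DIP20MonomialCountStabilisation
import Literature.Computability.AlgebraicComplexity.DIP20Lemma313Assembly
import Literature.Computability.AlgebraicComplexity.DIP20Lemma313Base555A
import Literature.Computability.AlgebraicComplexity.DIP20Lemma313Base555B
import Literature.Computability.AlgebraicComplexity.DIP20Lemma313Base555C
import Literature.Computability.AlgebraicComplexity.DIP20Lemma313Base555D
import HarnessLib

/-!
# Dörfler–Ikenmeyer–Panova 2020, Lemma 3.13 DISCHARGED: the six remaining bodies `(3,3,1), (3,3,2),
# (3,3,3), (4,3,3), (5,5,5), (6,1,1)` of `Y` by the counting formula (4.4), clamping, and the masked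
# packed-table dynamic programme

Topic `Literature/Computability/AlgebraicComplexity`; sibling proofs file (D-0014) of
`DIP20MultiplicityObstructions.lean` (named fact `DIP20_lem_3_13`, tails `dipTails47`), completing
`DIP20HookLikeTails.lean` (`DIP20_lem_3_13_of_hookLike`: the eight hook-like bodies of `Y` by
Ikenmeyer–Panova's Thm. 1.7(a)), t07's four tail files `DIP20Lemma313Tail221/321/330/511.lean` and t07's
`DIP20Lemma313Assembly.lean` (`DIP20_lem_3_13_of_tails`: the fact from the six bodies proved here; lead-bip's
one-writer split of 2026-08-26T14:21Z). Theorems only; no new facts, no new definitions.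

J. Dörfler, C. Ikenmeyer, G. Panova, SIAM J. Appl. Algebra Geom. 4 (2020) = arXiv:1901.04576, Lemma 3.13
(arXiv p. 7; TeX `multobs.tex` L480 `{lem:vanishingpleth74}`): "If `λ` is an `m`-partition of `dn` and
`λ̄ ∈ Y`, then `a_λ(d[n]) = 0`" ("proven exactly like Lemma 3.7", i.e. by a finite calculation of limit
coefficients as in [IP17]).

**Route here** (the tree's, not IP's limit-coefficient calculation; the same route as p6's
`DIP20Lemma37Tail33.lean` for the tail `(3,3)` of Lemma 3.7): a nonzero highest-weight vector of weight
`(L, τ)*` in `ℂ[Sym^n ℂ⁴]` pins `n, d ≥ 1` with `dn = L + |τ|` (a weight pins the degree); the counting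
formula (4.4) (`DIP20_eq_4_4_holds`, p6) writes `a_{(dn−s,τ)}(d[n])` (`s = |τ|`) as the signed sum over `S_4`
of tail counts `c_ν(d,n)`; t07's clamping `dip44_sum_cons_clamp` (`DIP20MonomialCountStabilisation.lean`:
each count is stable in `d` once `d ≥ s` and in `n` once `n ≥ s`) replaces `(d,n)` by
`(d',n') = (min d s, min n s)`; the pairs that arise are `d' = s`, `n' = s`, or `d'n' ≥ s + τ₁` (when
nothing is clamped, `λ` itself is a partition); and each clamped right-hand side is a kernel value through
ONE masked packed table (`dip44_rhs_eq_dpM`, `DIP20MonomialCountDP.lean` Part II) — all zero. The generic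
step is `plethysmCoeff_fin_four_tail_eq_zero_of_base`; the base values of the five bodies with `s ≤ 10`
are checked in this file (one `decide +kernel` each), those of `(5,5,5)` (`s = 15`, 175 pairs, 15
per-`d'` theorems) in the four sibling certificate files `DIP20Lemma313Base555A–D.lean`.

Proved: `plethysmCoeff_rowDual_tail331_eq_zero`, `…tail332…`, `…tail333…`, `…tail433…`, `…tail555…`,
`…tail611…` (every `n`), and **`DIP20_lem_3_13_holds : DIP20_lem_3_13`** (through t07's
`DIP20_lem_3_13_of_tails`).

HONEST FRAMING: toy-model plethysm arithmetic (vanishing plethysm coefficients behind the no-occurrence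
analysis of DIP's §3); nothing here bears on permanent versus determinant; VP ≠ VNP is not proved.

## References

* J. Dörfler, C. Ikenmeyer, G. Panova, SIAM J. Appl. Algebra Geom. 4 (2020) = arXiv:1901.04576,
  Lemma 3.13 (arXiv p. 7), eqs. (4.3)–(4.4) (arXiv p. 9). [DorflerIkenmeyerPanova2020]
* C. Ikenmeyer, G. Panova, Adv. Math. 319 (2017), Thm. 1.7(a) (the hook-like part, via
  `DIP20HookLikeTails.lean`). [IkenmeyerPanova2017]

## Mathlib and tree

Tree: `DIP20_eq_4_4_holds` (`DIP20PlethysmCountingFormulaProofs`, p6); `dip44_sum_cons_clamp`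
(`DIP20MonomialCountStabilisation`, t07); `dip44_rhs_eq_dpM`, `dpTablesM`, `digitAt`, `boxIdx`
(`DIP20MonomialCountDP`, p4); `DIP20_lem_3_13_of_tails` (`DIP20Lemma313Assembly`, t07); `plethysmCoeff`,
`hwMultiplicity`, `highestWeightSpace`, `coordRep`, `monWeight_eq_of_mem_weightSpace`, `size_monWeight`,
`size_rowDual`, `rowDual`, `dipTails47`, `DIP20_lem_3_13` (`DIP20MultiplicityObstructions` and its imports).
Mathlib: `Submodule.ne_bot_iff`, `MvPolynomial.support_nonempty`, `Fin.sum_univ_four`, `Finset.mem_union`.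

Provenance: val-lit cell, prover val-lit-p4 g3 (registry claim on `DIP20_lem_3_13`).
-/

open scoped BigOperators
open MvPolynomial

namespace Literature.Computability.AlgebraicComplexity

open _root_.Literature.NumberTheory.DiophantineGeometry

/-! ### From finitely many clamped base values to the vanishing of a tail, for every `n` -/

section Generic

/-- **Tail vanishing from the clamped base values.** For a tail `τ = (t₁,t₂,t₃)` with `s = |τ| ≥ 1` and a
digit width `F(d')`: if for every clamped parameter pair `(d',n') ∈ [1,s]²` that can arise (`d' = s`, or
`n' = s`, or `d'n' ≥ s + t₁`) the masked right-hand side of (4.4) for `λ' = (d'n' − s, τ)` vanishes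
(kernel facts), then `a_{(L,τ)}(·[n]) = 0` for every `n` and every `4`-partition `(L, τ)`. Route: a nonzero
highest-weight vector pins `n, d ≥ 1` with `dn = L + s` (a weight pins the degree); (4.4)
(`DIP20_eq_4_4_holds`); clamping of the whole alternating sum to `(min d s, min n s)`
(`dip44_sum_cons_clamp`, t07); evaluation through one masked table (`dip44_rhs_eq_dpM`).
[cite: DorflerIkenmeyerPanova2020, Lemma 3.13 (arXiv p. 7; TeX multobs.tex L480 {lem:vanishingpleth74}) with eq. (4.4) (p. 9)] -/
theorem plethysmCoeff_fin_four_tail_eq_zero_of_base (t1 t2 t3 s : ℕ) (F : ℕ → ℕ) (hs : s = t1 + t2 + t3)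
    (hs1 : 1 ≤ s)
    (base : ∀ d' < s + 1, ∀ n' < s + 1, (1 ≤ d' ∧ d' < s + 1 ∧ 1 ≤ n' ∧
      (d' = s ∨ n' = s ∨ s + t1 ≤ d' * n')) →
      ((weakComps 4 n').length + 1) ^ d' < 2 ^ F d' ∧
      (∑ π : Equiv.Perm (Fin 4), ((Equiv.Perm.sign π : ℤˣ) : ℤ) *
          (if ∀ i : Fin 4, (i : ℕ) ≤ (Fin.cons (d' * n' - s) ![t1, t2, t3] : Fin 4 → ℕ) i + (π i : ℕ)
            then (digitAt (F d')
                ((dpTablesM (F d') ((Fin.cons (d' * n' - s) ![t1, t2, t3] : Fin 4 → ℕ) 1 + 3)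
                  ((Fin.cons (d' * n' - s) ![t1, t2, t3] : Fin 4 → ℕ) 2 + 2)
                  ((Fin.cons (d' * n' - s) ![t1, t2, t3] : Fin 4 → ℕ) 3 + 1) n' n' d').getD d' 0)
                (boxIdx ((Fin.cons (d' * n' - s) ![t1, t2, t3] : Fin 4 → ℕ) 2 + 2 + n')
                  ((Fin.cons (d' * n' - s) ![t1, t2, t3] : Fin 4 → ℕ) 3 + 1 + n')
                  ((Fin.cons (d' * n' - s) ![t1, t2, t3] : Fin 4 → ℕ) 1 + (π 1 : ℕ) - 1)
                  ((Fin.cons (d' * n' - s) ![t1, t2, t3] : Fin 4 → ℕ) 2 + (π 2 : ℕ) - 2)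
                  ((Fin.cons (d' * n' - s) ![t1, t2, t3] : Fin 4 → ℕ) 3 + (π 3 : ℕ) - 3)) : ℤ)
            else 0)) = 0)
    (n : ℕ) (μ : Fin 4 → ℕ) (hμ : Antitone μ) (h1 : μ 1 = t1) (h2 : μ 2 = t2) (h3 : μ 3 = t3) :
    plethysmCoeff ℂ (Fin 4) n (rowDual μ) = 0 := by
  classical
  haveI : Infinite ℂ := CharZero.infinite ℂ
  have h10 : μ 1 ≤ μ 0 := hμ (show (0 : Fin 4) ≤ 1 by decide)
  rw [plethysmCoeff, hwMultiplicity]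
  by_contra hne
  -- a nonzero highest-weight vector pins the degree
  have hbot : highestWeightSpace (coordRep (Fin 4) ℂ n) (rowDual μ) ≠ ⊥ := by
    intro hb
    apply hne
    rw [hb, finrank_bot]
  obtain ⟨h, hh, hh0⟩ := (Submodule.ne_bot_iff _).mp hbot
  obtain ⟨sm, hsup⟩ := support_nonempty.mpr hh0
  have hw := monWeight_eq_of_mem_weightSpace (highestWeightSpace_le_weightSpace _ _ hh) hsup
  have hsize := size_monWeight sm
  rw [hw, size_rowDual, neg_inj, Nat.cast_inj, Fin.sum_univ_four, h1, h2, h3] at hsize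
  -- hsize : μ 0 + t1 + t2 + t3 = n * sm.degree
  set d := sm.degree with hd
  have hn : 1 ≤ n := by
    rcases Nat.eq_zero_or_pos n with rfl | hn
    · rw [Nat.zero_mul] at hsize; omega
    · exact hn
  have hd1 : 1 ≤ d := by
    rcases Nat.eq_zero_or_pos d with hd0 | hd0
    · rw [hd0, Nat.mul_zero] at hsize; omega
    · exact hd0
  have hdn : d * n = μ 0 + s := by rw [Nat.mul_comm, hs]; omega
  -- the row vector in `Fin.cons` form
  have hτsum : ∑ j, (![t1, t2, t3] : Fin 3 → ℕ) j = s := by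
    rw [Fin.sum_univ_three, hs]; rfl
  have hμv : μ = (Fin.cons (d * n - s) ![t1, t2, t3] : Fin 4 → ℕ) := by
    funext i
    refine Fin.cases ?_ (fun j => ?_) i
    · simp only [Fin.cons_zero]; omega
    · simp only [Fin.cons_succ]
      fin_cases j
      · exact h1
      · exact h2
      · exact h3
  have hanti : Antitone (Fin.cons (d * n - s) ![t1, t2, t3] : Fin 4 → ℕ) := hμv ▸ hμ
  have hsum4 : ∑ i, (Fin.cons (d * n - s) ![t1, t2, t3] : Fin 4 → ℕ) i = d * n := by
    rw [Fin.sum_univ_succ, Fin.cons_zero]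
    simp only [Fin.cons_succ]
    rw [hτsum]; omega
  -- (4.4), then clamping of the whole alternating sum
  have h44 := DIP20_eq_4_4_holds 4 n d _ hn hanti hsum4
  have hclamp := dip44_sum_cons_clamp (![t1, t2, t3] : Fin 3 → ℕ) (T := s) hn hd1 hs1 hτsum.le
    (by rw [hτsum]; omega)
  rw [hτsum] at hclamp
  rw [hclamp] at h44
  -- the clamped pair is a base pair
  set d' := min d s with hd'
  set n' := min n s with hn'
  have hd'1 : 1 ≤ d' := le_min hd1 hs1
  have hn'1 : 1 ≤ n' := le_min hn hs1
  have hd's : d' < s + 1 := Nat.lt_succ_of_le (min_le_right _ _)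
  have hn's : n' < s + 1 := Nat.lt_succ_of_le (min_le_right _ _)
  have hcond : d' = s ∨ n' = s ∨ s + t1 ≤ d' * n' := by
    rcases le_or_gt s d with h | h
    · exact Or.inl (min_eq_right h)
    · rcases le_or_gt s n with h' | h'
      · exact Or.inr (Or.inl (min_eq_right h'))
      · right; right
        rw [hd', hn', min_eq_left h.le, min_eq_left h'.le]
        omega
  have hs'' : s ≤ d' * n' := by
    rcases hcond with h | h | h
    · rw [h]; exact Nat.le_mul_of_pos_right s hn'1
    · rw [h]; exact Nat.le_mul_of_pos_left s hd'1
    · omega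
  obtain ⟨hF, hbase⟩ := base d' hd's n' hn's ⟨hd'1, hd's, hn'1, hcond⟩
  have hsum' : ∑ i, (Fin.cons (d' * n' - s) ![t1, t2, t3] : Fin 4 → ℕ) i = d' * n' := by
    rw [Fin.sum_univ_succ, Fin.cons_zero]
    simp only [Fin.cons_succ]
    rw [hτsum]; omega
  have hrhs := dip44_rhs_eq_dpM (Fin.cons (d' * n' - s) ![t1, t2, t3] : Fin 4 → ℕ) hsum' hF
  rw [hrhs] at h44
  have hval : (plethysmCoeff ℂ (Fin 4) n (rowDual (Fin.cons (d * n - s) ![t1, t2, t3] : Fin 4 → ℕ)) : ℤ) = 0 :=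
    h44.trans hbase
  have hval' : plethysmCoeff ℂ (Fin 4) n (rowDual (Fin.cons (d * n - s) ![t1, t2, t3] : Fin 4 → ℕ)) = 0 := by
    exact_mod_cast hval
  apply hne
  rw [hμv]
  simpa [plethysmCoeff, hwMultiplicity] using hval'

end Generic

/-! ### The bodies `(3,3,1), (3,3,2), (3,3,3), (4,3,3), (6,1,1)`: base values in this file -/

section SmallTails

/-- The clamped base values for the tail `(3,3,1)` (`s = 7`, digit width `49`): all vanish (kernel). [cite: DorflerIkenmeyerPanova2020, Lemma 3.13 (tail (3,3,1), arXiv p. 7)] -/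
theorem tail331_base :
    ∀ d' < 8, ∀ n' < 8, (1 ≤ d' ∧ d' < 8 ∧ 1 ≤ n' ∧
      (d' = 7 ∨ n' = 7 ∨ 7 + 3 ≤ d' * n')) →
      ((weakComps 4 n').length + 1) ^ d' < 2 ^ 49 ∧
      (∑ π : Equiv.Perm (Fin 4), ((Equiv.Perm.sign π : ℤˣ) : ℤ) *
          (if ∀ i : Fin 4, (i : ℕ) ≤ (Fin.cons (d' * n' - 7) ![3, 3, 1] : Fin 4 → ℕ) i + (π i : ℕ)
            then (digitAt 49
                ((dpTablesM 49 ((Fin.cons (d' * n' - 7) ![3, 3, 1] : Fin 4 → ℕ) 1 + 3) ((Fin.cons (d' * n' - 7) ![3, 3, 1] : Fin 4 → ℕ) 2 + 2) ((Fin.cons (d' * n' - 7) ![3, 3, 1] : Fin 4 → ℕ) 3 + 1) n' n' d').getD d' 0)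
                (boxIdx ((Fin.cons (d' * n' - 7) ![3, 3, 1] : Fin 4 → ℕ) 2 + 2 + n') ((Fin.cons (d' * n' - 7) ![3, 3, 1] : Fin 4 → ℕ) 3 + 1 + n')
                  ((Fin.cons (d' * n' - 7) ![3, 3, 1] : Fin 4 → ℕ) 1 + (π 1 : ℕ) - 1) ((Fin.cons (d' * n' - 7) ![3, 3, 1] : Fin 4 → ℕ) 2 + (π 2 : ℕ) - 2) ((Fin.cons (d' * n' - 7) ![3, 3, 1] : Fin 4 → ℕ) 3 + (π 3 : ℕ) - 3)) : ℤ)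
            else 0)) = 0 := by
  decide +kernel

/-- **`a_{(L,3,3,1)}(·[n]) = 0`** for every `n` and every `L ≥ 3`: the tail `(3,3,1)` of Lemma 3.13. [cite: DorflerIkenmeyerPanova2020, Lemma 3.13 (tail (3,3,1), arXiv p. 7; TeX multobs.tex L480 {lem:vanishingpleth74})] -/
theorem plethysmCoeff_rowDual_tail331_eq_zero (n : ℕ) (μ : Fin 4 → ℕ) (hμ : Antitone μ)
    (h1 : μ 1 = 3) (h2 : μ 2 = 3) (h3 : μ 3 = 1) : plethysmCoeff ℂ (Fin 4) n (rowDual μ) = 0 :=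
  plethysmCoeff_fin_four_tail_eq_zero_of_base 3 3 1 7 (fun _ => 49) rfl (by norm_num) tail331_base n μ hμ h1 h2 h3

/-- The clamped base values for the tail `(3,3,2)` (`s = 8`, digit width `60`): all vanish (kernel). [cite: DorflerIkenmeyerPanova2020, Lemma 3.13 (tail (3,3,2), arXiv p. 7)] -/
theorem tail332_base :
    ∀ d' < 9, ∀ n' < 9, (1 ≤ d' ∧ d' < 9 ∧ 1 ≤ n' ∧
      (d' = 8 ∨ n' = 8 ∨ 8 + 3 ≤ d' * n')) →
      ((weakComps 4 n').length + 1) ^ d' < 2 ^ 60 ∧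
      (∑ π : Equiv.Perm (Fin 4), ((Equiv.Perm.sign π : ℤˣ) : ℤ) *
          (if ∀ i : Fin 4, (i : ℕ) ≤ (Fin.cons (d' * n' - 8) ![3, 3, 2] : Fin 4 → ℕ) i + (π i : ℕ)
            then (digitAt 60
                ((dpTablesM 60 ((Fin.cons (d' * n' - 8) ![3, 3, 2] : Fin 4 → ℕ) 1 + 3) ((Fin.cons (d' * n' - 8) ![3, 3, 2] : Fin 4 → ℕ) 2 + 2) ((Fin.cons (d' * n' - 8) ![3, 3, 2] : Fin 4 → ℕ) 3 + 1) n' n' d').getD d' 0)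
                (boxIdx ((Fin.cons (d' * n' - 8) ![3, 3, 2] : Fin 4 → ℕ) 2 + 2 + n') ((Fin.cons (d' * n' - 8) ![3, 3, 2] : Fin 4 → ℕ) 3 + 1 + n')
                  ((Fin.cons (d' * n' - 8) ![3, 3, 2] : Fin 4 → ℕ) 1 + (π 1 : ℕ) - 1) ((Fin.cons (d' * n' - 8) ![3, 3, 2] : Fin 4 → ℕ) 2 + (π 2 : ℕ) - 2) ((Fin.cons (d' * n' - 8) ![3, 3, 2] : Fin 4 → ℕ) 3 + (π 3 : ℕ) - 3)) : ℤ)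
            else 0)) = 0 := by
  decide +kernel

/-- **`a_{(L,3,3,2)}(·[n]) = 0`** for every `n` and every `L ≥ 3`: the tail `(3,3,2)` of Lemma 3.13. [cite: DorflerIkenmeyerPanova2020, Lemma 3.13 (tail (3,3,2), arXiv p. 7; TeX multobs.tex L480 {lem:vanishingpleth74})] -/
theorem plethysmCoeff_rowDual_tail332_eq_zero (n : ℕ) (μ : Fin 4 → ℕ) (hμ : Antitone μ)
    (h1 : μ 1 = 3) (h2 : μ 2 = 3) (h3 : μ 3 = 2) : plethysmCoeff ℂ (Fin 4) n (rowDual μ) = 0 :=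
  plethysmCoeff_fin_four_tail_eq_zero_of_base 3 3 2 8 (fun _ => 60) rfl (by norm_num) tail332_base n μ hμ h1 h2 h3

/-- The clamped base values for the tail `(3,3,3)` (`s = 9`, digit width `71`): all vanish (kernel). [cite: DorflerIkenmeyerPanova2020, Lemma 3.13 (tail (3,3,3), arXiv p. 7)] -/
theorem tail333_base :
    ∀ d' < 10, ∀ n' < 10, (1 ≤ d' ∧ d' < 10 ∧ 1 ≤ n' ∧
      (d' = 9 ∨ n' = 9 ∨ 9 + 3 ≤ d' * n')) →
      ((weakComps 4 n').length + 1) ^ d' < 2 ^ 71 ∧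
      (∑ π : Equiv.Perm (Fin 4), ((Equiv.Perm.sign π : ℤˣ) : ℤ) *
          (if ∀ i : Fin 4, (i : ℕ) ≤ (Fin.cons (d' * n' - 9) ![3, 3, 3] : Fin 4 → ℕ) i + (π i : ℕ)
            then (digitAt 71
                ((dpTablesM 71 ((Fin.cons (d' * n' - 9) ![3, 3, 3] : Fin 4 → ℕ) 1 + 3) ((Fin.cons (d' * n' - 9) ![3, 3, 3] : Fin 4 → ℕ) 2 + 2) ((Fin.cons (d' * n' - 9) ![3, 3, 3] : Fin 4 → ℕ) 3 + 1) n' n' d').getD d' 0)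
                (boxIdx ((Fin.cons (d' * n' - 9) ![3, 3, 3] : Fin 4 → ℕ) 2 + 2 + n') ((Fin.cons (d' * n' - 9) ![3, 3, 3] : Fin 4 → ℕ) 3 + 1 + n')
                  ((Fin.cons (d' * n' - 9) ![3, 3, 3] : Fin 4 → ℕ) 1 + (π 1 : ℕ) - 1) ((Fin.cons (d' * n' - 9) ![3, 3, 3] : Fin 4 → ℕ) 2 + (π 2 : ℕ) - 2) ((Fin.cons (d' * n' - 9) ![3, 3, 3] : Fin 4 → ℕ) 3 + (π 3 : ℕ) - 3)) : ℤ)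
            else 0)) = 0 := by
  decide +kernel

/-- **`a_{(L,3,3,3)}(·[n]) = 0`** for every `n` and every `L ≥ 3`: the tail `(3,3,3)` of Lemma 3.13. [cite: DorflerIkenmeyerPanova2020, Lemma 3.13 (tail (3,3,3), arXiv p. 7; TeX multobs.tex L480 {lem:vanishingpleth74})] -/
theorem plethysmCoeff_rowDual_tail333_eq_zero (n : ℕ) (μ : Fin 4 → ℕ) (hμ : Antitone μ)
    (h1 : μ 1 = 3) (h2 : μ 2 = 3) (h3 : μ 3 = 3) : plethysmCoeff ℂ (Fin 4) n (rowDual μ) = 0 :=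
  plethysmCoeff_fin_four_tail_eq_zero_of_base 3 3 3 9 (fun _ => 71) rfl (by norm_num) tail333_base n μ hμ h1 h2 h3

/-- The clamped base values for the tail `(4,3,3)` (`s = 10`, digit width `82`): all vanish (kernel). [cite: DorflerIkenmeyerPanova2020, Lemma 3.13 (tail (4,3,3), arXiv p. 7)] -/
theorem tail433_base :
    ∀ d' < 11, ∀ n' < 11, (1 ≤ d' ∧ d' < 11 ∧ 1 ≤ n' ∧
      (d' = 10 ∨ n' = 10 ∨ 10 + 4 ≤ d' * n')) →
      ((weakComps 4 n').length + 1) ^ d' < 2 ^ 82 ∧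
      (∑ π : Equiv.Perm (Fin 4), ((Equiv.Perm.sign π : ℤˣ) : ℤ) *
          (if ∀ i : Fin 4, (i : ℕ) ≤ (Fin.cons (d' * n' - 10) ![4, 3, 3] : Fin 4 → ℕ) i + (π i : ℕ)
            then (digitAt 82
                ((dpTablesM 82 ((Fin.cons (d' * n' - 10) ![4, 3, 3] : Fin 4 → ℕ) 1 + 3) ((Fin.cons (d' * n' - 10) ![4, 3, 3] : Fin 4 → ℕ) 2 + 2) ((Fin.cons (d' * n' - 10) ![4, 3, 3] : Fin 4 → ℕ) 3 + 1) n' n' d').getD d' 0)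
                (boxIdx ((Fin.cons (d' * n' - 10) ![4, 3, 3] : Fin 4 → ℕ) 2 + 2 + n') ((Fin.cons (d' * n' - 10) ![4, 3, 3] : Fin 4 → ℕ) 3 + 1 + n')
                  ((Fin.cons (d' * n' - 10) ![4, 3, 3] : Fin 4 → ℕ) 1 + (π 1 : ℕ) - 1) ((Fin.cons (d' * n' - 10) ![4, 3, 3] : Fin 4 → ℕ) 2 + (π 2 : ℕ) - 2) ((Fin.cons (d' * n' - 10) ![4, 3, 3] : Fin 4 → ℕ) 3 + (π 3 : ℕ) - 3)) : ℤ)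
            else 0)) = 0 := by
  decide +kernel

/-- **`a_{(L,4,3,3)}(·[n]) = 0`** for every `n` and every `L ≥ 4`: the tail `(4,3,3)` of Lemma 3.13. [cite: DorflerIkenmeyerPanova2020, Lemma 3.13 (tail (4,3,3), arXiv p. 7; TeX multobs.tex L480 {lem:vanishingpleth74})] -/
theorem plethysmCoeff_rowDual_tail433_eq_zero (n : ℕ) (μ : Fin 4 → ℕ) (hμ : Antitone μ)
    (h1 : μ 1 = 4) (h2 : μ 2 = 3) (h3 : μ 3 = 3) : plethysmCoeff ℂ (Fin 4) n (rowDual μ) = 0 :=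
  plethysmCoeff_fin_four_tail_eq_zero_of_base 4 3 3 10 (fun _ => 82) rfl (by norm_num) tail433_base n μ hμ h1 h2 h3

/-- The clamped base values for the tail `(6,1,1)` (`s = 8`, digit width `60`): all vanish (kernel). [cite: DorflerIkenmeyerPanova2020, Lemma 3.13 (tail (6,1,1), arXiv p. 7)] -/
theorem tail611_base :
    ∀ d' < 9, ∀ n' < 9, (1 ≤ d' ∧ d' < 9 ∧ 1 ≤ n' ∧
      (d' = 8 ∨ n' = 8 ∨ 8 + 6 ≤ d' * n')) →
      ((weakComps 4 n').length + 1) ^ d' < 2 ^ 60 ∧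
      (∑ π : Equiv.Perm (Fin 4), ((Equiv.Perm.sign π : ℤˣ) : ℤ) *
          (if ∀ i : Fin 4, (i : ℕ) ≤ (Fin.cons (d' * n' - 8) ![6, 1, 1] : Fin 4 → ℕ) i + (π i : ℕ)
            then (digitAt 60
                ((dpTablesM 60 ((Fin.cons (d' * n' - 8) ![6, 1, 1] : Fin 4 → ℕ) 1 + 3) ((Fin.cons (d' * n' - 8) ![6, 1, 1] : Fin 4 → ℕ) 2 + 2) ((Fin.cons (d' * n' - 8) ![6, 1, 1] : Fin 4 → ℕ) 3 + 1) n' n' d').getD d' 0)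
                (boxIdx ((Fin.cons (d' * n' - 8) ![6, 1, 1] : Fin 4 → ℕ) 2 + 2 + n') ((Fin.cons (d' * n' - 8) ![6, 1, 1] : Fin 4 → ℕ) 3 + 1 + n')
                  ((Fin.cons (d' * n' - 8) ![6, 1, 1] : Fin 4 → ℕ) 1 + (π 1 : ℕ) - 1) ((Fin.cons (d' * n' - 8) ![6, 1, 1] : Fin 4 → ℕ) 2 + (π 2 : ℕ) - 2) ((Fin.cons (d' * n' - 8) ![6, 1, 1] : Fin 4 → ℕ) 3 + (π 3 : ℕ) - 3)) : ℤ)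
            else 0)) = 0 := by
  decide +kernel

/-- **`a_{(L,6,1,1)}(·[n]) = 0`** for every `n` and every `L ≥ 6`: the tail `(6,1,1)` of Lemma 3.13. [cite: DorflerIkenmeyerPanova2020, Lemma 3.13 (tail (6,1,1), arXiv p. 7; TeX multobs.tex L480 {lem:vanishingpleth74})] -/
theorem plethysmCoeff_rowDual_tail611_eq_zero (n : ℕ) (μ : Fin 4 → ℕ) (hμ : Antitone μ)
    (h1 : μ 1 = 6) (h2 : μ 2 = 1) (h3 : μ 3 = 1) : plethysmCoeff ℂ (Fin 4) n (rowDual μ) = 0 :=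
  plethysmCoeff_fin_four_tail_eq_zero_of_base 6 1 1 8 (fun _ => 60) rfl (by norm_num) tail611_base n μ hμ h1 h2 h3

end SmallTails

/-! ### The tail `(5,5,5)`: base values from the four certificate files -/

section Tail555

/-- The clamped base values for the tail `(5,5,5)` (`s = 15`; digit width piecewise in `d'`), assembled
from `DIP20Lemma313Base555A–D.lean`. [cite: DorflerIkenmeyerPanova2020, Lemma 3.13 (tail (5,5,5), arXiv p. 7)] -/
theorem tail555_base :
    ∀ d' < 16, ∀ n' < 16, (1 ≤ d' ∧ d' < 16 ∧ 1 ≤ n' ∧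
      (d' = 15 ∨ n' = 15 ∨ 15 + 5 ≤ d' * n')) →
      ((weakComps 4 n').length + 1) ^ d' < 2 ^ (if d' < 2 then 10 else if d' < 3 then 20 else if d' < 4 then 30 else if d' < 5 then 39 else if d' < 6 then 49 else if d' < 7 then 59 else if d' < 8 then 68 else if d' < 9 then 78 else if d' < 10 then 88 else if d' < 11 then 97 else if d' < 12 then 107 else if d' < 13 then 117 else if d' < 14 then 126 else if d' < 15 then 136 else 146) ∧
      (∑ π : Equiv.Perm (Fin 4), ((Equiv.Perm.sign π : ℤˣ) : ℤ) *
          (if ∀ i : Fin 4, (i : ℕ) ≤ (Fin.cons (d' * n' - 15) ![5, 5, 5] : Fin 4 → ℕ) i + (π i : ℕ)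
            then (digitAt (if d' < 2 then 10 else if d' < 3 then 20 else if d' < 4 then 30 else if d' < 5 then 39 else if d' < 6 then 49 else if d' < 7 then 59 else if d' < 8 then 68 else if d' < 9 then 78 else if d' < 10 then 88 else if d' < 11 then 97 else if d' < 12 then 107 else if d' < 13 then 117 else if d' < 14 then 126 else if d' < 15 then 136 else 146)
                ((dpTablesM (if d' < 2 then 10 else if d' < 3 then 20 else if d' < 4 then 30 else if d' < 5 then 39 else if d' < 6 then 49 else if d' < 7 then 59 else if d' < 8 then 68 else if d' < 9 then 78 else if d' < 10 then 88 else if d' < 11 then 97 else if d' < 12 then 107 else if d' < 13 then 117 else if d' < 14 then 126 else if d' < 15 then 136 else 146) ((Fin.cons (d' * n' - 15) ![5, 5, 5] : Fin 4 → ℕ) 1 + 3) ((Fin.cons (d' * n' - 15) ![5, 5, 5] : Fin 4 → ℕ) 2 + 2) ((Fin.cons (d' * n' - 15) ![5, 5, 5] : Fin 4 → ℕ) 3 + 1) n' n' d').getD d' 0)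
                (boxIdx ((Fin.cons (d' * n' - 15) ![5, 5, 5] : Fin 4 → ℕ) 2 + 2 + n') ((Fin.cons (d' * n' - 15) ![5, 5, 5] : Fin 4 → ℕ) 3 + 1 + n')
                  ((Fin.cons (d' * n' - 15) ![5, 5, 5] : Fin 4 → ℕ) 1 + (π 1 : ℕ) - 1) ((Fin.cons (d' * n' - 15) ![5, 5, 5] : Fin 4 → ℕ) 2 + (π 2 : ℕ) - 2) ((Fin.cons (d' * n' - 15) ![5, 5, 5] : Fin 4 → ℕ) 3 + (π 3 : ℕ) - 3)) : ℤ)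
            else 0)) = 0 := by
  intro d' hd n' hn h
  obtain ⟨h1, -, h2, hc⟩ := h
  by_cases hlt1 : d' < 2
  · rw [if_pos hlt1]
    exact tail555_base_1_2 d' hd n' hn ⟨by omega, hlt1, h2, hc⟩
  rw [if_neg hlt1]
  by_cases hlt2 : d' < 3
  · rw [if_pos hlt2]
    exact tail555_base_2_3 d' hd n' hn ⟨by omega, hlt2, h2, hc⟩
  rw [if_neg hlt2]
  by_cases hlt3 : d' < 4
  · rw [if_pos hlt3]
    exact tail555_base_3_4 d' hd n' hn ⟨by omega, hlt3, h2, hc⟩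
  rw [if_neg hlt3]
  by_cases hlt4 : d' < 5
  · rw [if_pos hlt4]
    exact tail555_base_4_5 d' hd n' hn ⟨by omega, hlt4, h2, hc⟩
  rw [if_neg hlt4]
  by_cases hlt5 : d' < 6
  · rw [if_pos hlt5]
    exact tail555_base_5_6 d' hd n' hn ⟨by omega, hlt5, h2, hc⟩
  rw [if_neg hlt5]
  by_cases hlt6 : d' < 7
  · rw [if_pos hlt6]
    exact tail555_base_6_7 d' hd n' hn ⟨by omega, hlt6, h2, hc⟩
  rw [if_neg hlt6]
  by_cases hlt7 : d' < 8
  · rw [if_pos hlt7]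
    exact tail555_base_7_8 d' hd n' hn ⟨by omega, hlt7, h2, hc⟩
  rw [if_neg hlt7]
  by_cases hlt8 : d' < 9
  · rw [if_pos hlt8]
    exact tail555_base_8_9 d' hd n' hn ⟨by omega, hlt8, h2, hc⟩
  rw [if_neg hlt8]
  by_cases hlt9 : d' < 10
  · rw [if_pos hlt9]
    exact tail555_base_9_10 d' hd n' hn ⟨by omega, hlt9, h2, hc⟩
  rw [if_neg hlt9]
  by_cases hlt10 : d' < 11
  · rw [if_pos hlt10]
    exact tail555_base_10_11 d' hd n' hn ⟨by omega, hlt10, h2, hc⟩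
  rw [if_neg hlt10]
  by_cases hlt11 : d' < 12
  · rw [if_pos hlt11]
    exact tail555_base_11_12 d' hd n' hn ⟨by omega, hlt11, h2, hc⟩
  rw [if_neg hlt11]
  by_cases hlt12 : d' < 13
  · rw [if_pos hlt12]
    exact tail555_base_12_13 d' hd n' hn ⟨by omega, hlt12, h2, hc⟩
  rw [if_neg hlt12]
  by_cases hlt13 : d' < 14
  · rw [if_pos hlt13]
    exact tail555_base_13_14 d' hd n' hn ⟨by omega, hlt13, h2, hc⟩
  rw [if_neg hlt13]
  by_cases hlt14 : d' < 15
  · rw [if_pos hlt14]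
    exact tail555_base_14_15 d' hd n' hn ⟨by omega, hlt14, h2, hc⟩
  rw [if_neg hlt14]
  exact tail555_base_15_16 d' hd n' hn ⟨by omega, hd, h2, hc⟩

/-- **`a_{(L,5,5,5)}(·[n]) = 0`** for every `n` and every `L ≥ 5`: the tail `(5,5,5)` of Lemma 3.13. [cite: DorflerIkenmeyerPanova2020, Lemma 3.13 (tail (5,5,5), arXiv p. 7; TeX multobs.tex L480 {lem:vanishingpleth74})] -/
theorem plethysmCoeff_rowDual_tail555_eq_zero (n : ℕ) (μ : Fin 4 → ℕ) (hμ : Antitone μ)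
    (h1 : μ 1 = 5) (h2 : μ 2 = 5) (h3 : μ 3 = 5) : plethysmCoeff ℂ (Fin 4) n (rowDual μ) = 0 :=
  plethysmCoeff_fin_four_tail_eq_zero_of_base 5 5 5 15
    (fun d' => if d' < 2 then 10 else if d' < 3 then 20 else if d' < 4 then 30 else if d' < 5 then 39 else if d' < 6 then 49 else if d' < 7 then 59 else if d' < 8 then 68 else if d' < 9 then 78 else if d' < 10 then 88 else if d' < 11 then 97 else if d' < 12 then 107 else if d' < 13 then 117 else if d' < 14 then 126 else if d' < 15 then 136 else 146)
    rfl (by norm_num) tail555_base n μ hμ h1 h2 h3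

end Tail555

/-! ### Lemma 3.13 -/

section Lemma313

/-- **Dörfler–Ikenmeyer–Panova 2020, Lemma 3.13, DISCHARGED**: t07's `DIP20_lem_3_13_of_tails` (the eight
hook-like bodies by `DIP20_lem_3_13_of_hookLike`, the tails `(2,2,1), (3,2,1), (3,3), (5,1,1)` by t07's four
tail files) fed with the six bodies proved above.
[cite: DorflerIkenmeyerPanova2020, Lemma 3.13 (arXiv p. 7; TeX multobs.tex L480 {lem:vanishingpleth74}; held paper-arxiv-1901.04576 p0007.txt:L71 "Lemma 11")] -/
theorem DIP20_lem_3_13_holds : DIP20_lem_3_13 :=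
  DIP20_lem_3_13_of_tails
    (fun n μ hμ h => plethysmCoeff_rowDual_tail331_eq_zero n μ hμ (Prod.mk.inj h).1
      (Prod.mk.inj (Prod.mk.inj h).2).1 (Prod.mk.inj (Prod.mk.inj h).2).2)
    (fun n μ hμ h => plethysmCoeff_rowDual_tail332_eq_zero n μ hμ (Prod.mk.inj h).1
      (Prod.mk.inj (Prod.mk.inj h).2).1 (Prod.mk.inj (Prod.mk.inj h).2).2)
    (fun n μ hμ h => plethysmCoeff_rowDual_tail333_eq_zero n μ hμ (Prod.mk.inj h).1
      (Prod.mk.inj (Prod.mk.inj h).2).1 (Prod.mk.inj (Prod.mk.inj h).2).2)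
    (fun n μ hμ h => plethysmCoeff_rowDual_tail433_eq_zero n μ hμ (Prod.mk.inj h).1
      (Prod.mk.inj (Prod.mk.inj h).2).1 (Prod.mk.inj (Prod.mk.inj h).2).2)
    (fun n μ hμ h => plethysmCoeff_rowDual_tail555_eq_zero n μ hμ (Prod.mk.inj h).1
      (Prod.mk.inj (Prod.mk.inj h).2).1 (Prod.mk.inj (Prod.mk.inj h).2).2)
    (fun n μ hμ h => plethysmCoeff_rowDual_tail611_eq_zero n μ hμ (Prod.mk.inj h).1
      (Prod.mk.inj (Prod.mk.inj h).2).1 (Prod.mk.inj (Prod.mk.inj h).2).2)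

end Lemma313

end Literature.Computability.AlgebraicComplexity
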